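import Summits.NavierStokesRegularity.NavierStokesRegularity.Theorems.PoloidalWindowDoorPoloidalWindowRigidityZShockPSystemNonuniform
import HarnessLib

/-!
# Crux K2 `PoloidalWindowRigidity` (stmt-NavierStokesRegularity-19708), line `z_shock` — RUNG R2 WITHOUT ANY SIGN HYPOTHESIS,
# ONE-FAMILY CASE: eternal scalar transport with a nowhere linearly degenerate speed is constant; simple waves and travelling
# waves of the autonomous p-system are constant states whatever the sign pattern of `κ'`

`--supports stmt-NavierStokesRegularity-19708 --as helper` (leafhand-ns-poloidalwindowdoor-3 g3, cell decomp-ns, 2026-08-31).  Class-free,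
Mathlib + tree files only.  **No stub and no summit is closed by this file; Navier–Stokes regularity is NOT proved here (rung 0).**

Context.  The standing repair census of the crux (hands 3-g1/3-g2) lists, as the only hand-sized residue of the 1-D shadow R2 of the
deciding stub `stub_zShockThickAut`, the case of a SIGN-CHANGING genuine-nonlinearity coefficient `κ'` (`κ' ≢ 0` on intervals but
with interior critical values; Klainerman–Majda's degenerate string).  The tree theorem `…PSystemNonuniformConst.pSystem_const_nonuniform`
(p823120) needs `κ' ≥ 0` (or `≤ 0`) on the range.  This file shows that the sign hypothesis is needed ONLY for the interaction of the
two characteristic families: every ONE-FAMILY eternal solution is trivial with no sign hypothesis at all.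

* `eternal_transport_const` — ★ if `u : ℝ × ℝ → ℝ` is differentiable, `u_z + c(u) u_x = 0` on all of `ℝ × ℝ` (two-sided in the
  height `z` = first coordinate), `c ∈ C¹` with `c(u)`, `c'(u)`, `u_x` bounded along the solution, and `c` is NOWHERE LINEARLY
  DEGENERATE (`c' ≢ 0` on every nontrivial interval — no sign, no convexity), then `u` is constant.  Mechanism: `u` is constant along
  every global characteristic, so every characteristic is a straight LINE `x = x₀ + c(u(z₀,x₀))(z − z₀)` defined for all `z ∈ ℝ`;
  two lines with different slopes cross at some (past or future) height, where `u` would take both values — so all slopes on a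
  slice agree (`speed_eq_on_slice`), the slice takes values in one level set of `c`, which contains no interval, so the slice is
  constant (`slice_const`), and transport along characteristics makes `u` constant.  (For convex `c` this is Lax 1964 read
  two-sidedly; the point is that convexity is irrelevant for a single family.)
* `pSystem_const_of_backward_flat` / `pSystem_const_of_forward_flat` — for the autonomous p-system `p_z = −κ(w)² w_x`,
  `w_z = −p_x`: if ONE Riemann invariant has identically vanishing transversal derivative (`p_x ∓ κ(w) w_x ≡ 0`, i.e. the solution
  is a simple wave of the other family), then `(w, p)` is a constant state — `κ > 0`, `κ ∈ C¹` nowhere linearly degenerate, NO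
  hypothesis on the sign of `κ'`.
* `deriv_eq_zero_of_mul_eq_zero` / `travellingWave_const` — a `C¹` profile `f` with `f'(ξ) · Φ(f ξ) = 0` everywhere, where the
  zero set of `Φ` contains no interval, is constant; hence every `C¹` travelling wave `(w, p)(z, x) = (f, g)(x − σ z)` of the
  p-system (`f' (σ² − κ(f)²) = 0`) is a constant state, again with no sign hypothesis on `κ'`.

So the sign-changing residue of the census is a genuinely TWO-FAMILY (interaction) phenomenon: any non-constant two-sided bounded
`C¹_b` solution with sign-changing `κ'` has BOTH `r_x ≢ 0` and `s_x ≢ 0` and is not a travelling wave. [folklore] (method of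
characteristics; Lax 1964, John 1974, Klainerman–Majda 1980 for the forward-in-time blow-up statements)
-/

noncomputable section

namespace Summit.NavierStokesRegularity.NavierStokesRegularity.Theorems.PoloidalWindowDoorPoloidalWindowRigidityZShockScalarEternal

-- the summit and its single sub-problem share the name (CONVENTIONS §1)
set_option linter.dupNamespace false

open Set Filter Topology Function Metric
open scoped NNReal
open Summit.NavierStokesRegularity.NavierStokesRegularity.Theorems.PoloidalWindowDoorPoloidalWindowRigidityZShockGlobalCharacteristics
open Summit.NavierStokesRegularity.NavierStokesRegularity.Theorems.PoloidalWindowDoorPoloidalWindowRigidityZShockPSystemNonuniform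

variable {u : ℝ × ℝ → ℝ} {c c' : ℝ → ℝ} {B k₁ U₁ : ℝ}

/-! ## Tools: lines, the speed field, global characteristics -/

/-- A function on `ℝ` with constant derivative `m` is affine: `X z = X z₀ + m (z − z₀)`. [folklore] -/
theorem eq_line_of_hasDerivAt_const {X : ℝ → ℝ} {m : ℝ} (hX : ∀ z, HasDerivAt X m z) (z z₀ : ℝ) :
    X z = X z₀ + m * (z - z₀) := by
  have h : ∀ t, HasDerivAt (fun t => X t - m * (t - z₀)) 0 t := by
    intro t
    have h1 : HasDerivAt (fun t => m * (t - z₀)) (m * 1) t := ((hasDerivAt_id t).sub_const z₀).const_mul m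
    have h2 : HasDerivAt (fun t => X t - m * (t - z₀)) (m - m * 1) t := (hX t).sub h1
    convert h2 using 1
    ring
  have hc := is_const_of_deriv_eq_zero (fun t => (h t).differentiableAt) (fun t => (h t).deriv) z z₀
  simp only [sub_self, mul_zero, sub_zero] at hc
  linarith

/-- The speed field `q ↦ c (u q)` is differentiable. [folklore] -/
theorem speed_differentiable (hu : Differentiable ℝ u) (hcd : ∀ v, HasDerivAt c (c' v) v) :
    Differentiable ℝ fun q : ℝ × ℝ => c (u q) := fun q =>
  (hcd (u q)).differentiableAt.comp q (hu q)

/-- Chain rule for the speed field: `D(c ∘ u)(q) h = c'(u q) · Du(q) h`. [folklore] -/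
theorem speed_fderiv (hu : Differentiable ℝ u) (hcd : ∀ v, HasDerivAt c (c' v) v) (q h : ℝ × ℝ) :
    fderiv ℝ (fun q : ℝ × ℝ => c (u q)) q h = c' (u q) * fderiv ℝ u q h := by
  have H : HasFDerivAt (fun q : ℝ × ℝ => c (u q)) (c' (u q) • fderiv ℝ u q) q :=
    (hcd (u q)).comp_hasFDerivAt q (hu q).hasFDerivAt
  rw [H.fderiv]
  rfl

/-- **Global characteristics.**  If `c(u)`, `c'(u)` and `u_x` are bounded along the solution, through every `(z₀, x₀)` passes a
characteristic `X' = c(u(z, X z))` defined for ALL `z ∈ ℝ` (the speed field is bounded and uniformly Lipschitz in `x`;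
`…ZShockGlobalCharacteristics.exists_global_solution`). [folklore] -/
theorem exists_global_char (hu : Differentiable ℝ u) (hcd : ∀ v, HasDerivAt c (c' v) v)
    (hB : ∀ q, |c (u q)| ≤ B) (hk₁ : ∀ q, |c' (u q)| ≤ k₁) (hU₁ : ∀ q, |fderiv ℝ u q (0, 1)| ≤ U₁) (z₀ x₀ : ℝ) :
    ∃ X : ℝ → ℝ, X z₀ = x₀ ∧ ∀ z, HasDerivAt X (c (u (z, X z))) z := by
  set F : ℝ → ℝ → ℝ := fun z x => c (u (z, x)) with hF
  have hd := speed_differentiable hu hcd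
  have hslice : ∀ z x, HasDerivAt (F z) (c' (u (z, x)) * fderiv ℝ u (z, x) (0, 1)) x := by
    intro z x
    have hγ : HasDerivAt (fun x' : ℝ => ((z, x') : ℝ × ℝ)) ((0 : ℝ), (1 : ℝ)) x :=
      (hasDerivAt_const x z).prodMk (hasDerivAt_id x)
    have h := (hd (z, x)).hasFDerivAt.comp_hasDerivAt x hγ
    rw [speed_fderiv hu hcd] at h
    exact h
  have hK : ∀ z, LipschitzWith (k₁ * U₁).toNNReal (F z) := by
    intro z
    refine lipschitzWith_of_nnnorm_deriv_le (fun x => (hslice z x).differentiableAt) fun x => ?_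
    rw [(hslice z x).deriv, ← NNReal.coe_le_coe, coe_nnnorm, Real.norm_eq_abs, abs_mul]
    refine le_trans ?_ (Real.le_coe_toNNReal _)
    have h1 := hk₁ (z, x)
    have h2 := hU₁ (z, x)
    exact mul_le_mul h1 h2 (abs_nonneg _) ((abs_nonneg _).trans h1)
  have hcont : ∀ x, Continuous fun z => F z x := fun x =>
    hd.continuous.comp (continuous_id.prodMk continuous_const)
  have hB' : ∀ z x, ‖F z x‖ ≤ ((B.toNNReal : ℝ≥0) : ℝ) := fun z x => by
    rw [Real.norm_eq_abs]
    exact (hB (z, x)).trans (Real.le_coe_toNNReal B)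
  exact exists_global_solution hK hcont hB' z₀ x₀

/-- Along a characteristic `u` is constant, so the characteristic is the straight line of slope `c(u(z₀, x₀))`. [folklore] -/
theorem char_is_line (hu : Differentiable ℝ u)
    (hPDE : ∀ q, fderiv ℝ u q (1, 0) + c (u q) * fderiv ℝ u q (0, 1) = 0)
    {X : ℝ → ℝ} {z₀ x₀ : ℝ} (hX0 : X z₀ = x₀) (hX : ∀ z, HasDerivAt X (c (u (z, X z))) z) :
    (∀ z, u (z, X z) = u (z₀, x₀)) ∧ ∀ z, X z = x₀ + c (u (z₀, x₀)) * (z - z₀) := by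
  have hconst : ∀ z, u (z, X z) = u (z₀, x₀) := by
    intro z
    have h := const_along (c := fun q => c (u q)) hu hPDE hX z z₀
    rwa [hX0] at h
  refine ⟨hconst, fun z => ?_⟩
  have hX' : ∀ z, HasDerivAt X (c (u (z₀, x₀))) z := fun z => by
    have h := hX z
    rwa [hconst z] at h
  have h := eq_line_of_hasDerivAt_const hX' z z₀
  rwa [hX0] at h

/-! ## The eternal scalar Liouville theorem without convexity -/

/-- **All characteristic slopes on a slice agree** (two non-parallel lines cross two-sidedly, and `u` is constant on each).
[folklore] -/
theorem speed_eq_on_slice (hu : Differentiable ℝ u) (hcd : ∀ v, HasDerivAt c (c' v) v)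
    (hPDE : ∀ q, fderiv ℝ u q (1, 0) + c (u q) * fderiv ℝ u q (0, 1) = 0)
    (hB : ∀ q, |c (u q)| ≤ B) (hk₁ : ∀ q, |c' (u q)| ≤ k₁) (hU₁ : ∀ q, |fderiv ℝ u q (0, 1)| ≤ U₁)
    (z₀ x₁ x₂ : ℝ) : c (u (z₀, x₁)) = c (u (z₀, x₂)) := by
  by_contra hne
  obtain ⟨X₁, h10, h1⟩ := exists_global_char hu hcd hB hk₁ hU₁ z₀ x₁
  obtain ⟨X₂, h20, h2⟩ := exists_global_char hu hcd hB hk₁ hU₁ z₀ x₂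
  obtain ⟨hu1, hX1⟩ := char_is_line hu hPDE h10 h1
  obtain ⟨hu2, hX2⟩ := char_is_line hu hPDE h20 h2
  set m₁ := c (u (z₀, x₁)) with hm₁
  set m₂ := c (u (z₀, x₂)) with hm₂
  have hm : m₁ - m₂ ≠ 0 := sub_ne_zero.2 hne
  -- the crossing height
  set d : ℝ := (x₂ - x₁) / (m₁ - m₂) with hd
  have hcross : X₁ (z₀ + d) = X₂ (z₀ + d) := by
    rw [hX1, hX2, hd]
    field_simp
    ring
  apply hne
  show c (u (z₀, x₁)) = c (u (z₀, x₂))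
  rw [← hu1 (z₀ + d), hcross, hu2]

/-- If `c` is constant on a nontrivial open interval around `v`, then `c' v = 0`. [folklore] -/
theorem deriv_zero_of_const_Ioo {a b v m : ℝ} (hv : v ∈ Ioo a b) (hc : ∀ y ∈ Ioo a b, c y = m)
    (hcd : HasDerivAt c (c' v) v) : c' v = 0 := by
  have hev : c =ᶠ[𝓝 v] fun _ => m := by
    filter_upwards [Ioo_mem_nhds hv.1 hv.2] with y hy using hc y hy
  have h0 : HasDerivAt c 0 v := (hasDerivAt_const v m).congr_of_eventuallyEq hev
  exact hcd.unique h0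

/-- **Every slice is constant**: the slice `x ↦ u (z₀, x)` takes values in one level set of `c` (`speed_eq_on_slice`); its image
is an interval (continuity), and a level set of a nowhere linearly degenerate `c` contains no nontrivial interval. [folklore] -/
theorem slice_const (hu : Differentiable ℝ u) (hcd : ∀ v, HasDerivAt c (c' v) v)
    (hPDE : ∀ q, fderiv ℝ u q (1, 0) + c (u q) * fderiv ℝ u q (0, 1) = 0)
    (hB : ∀ q, |c (u q)| ≤ B) (hk₁ : ∀ q, |c' (u q)| ≤ k₁) (hU₁ : ∀ q, |fderiv ℝ u q (0, 1)| ≤ U₁)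
    (hgn : ∀ a b : ℝ, a < b → ∃ v ∈ Ioo a b, c' v ≠ 0)
    (z₀ x₁ x₂ : ℝ) : u (z₀, x₁) = u (z₀, x₂) := by
  -- the image of the slice is order-connected
  have hcont : Continuous fun x : ℝ => u (z₀, x) := hu.continuous.comp (continuous_const.prodMk continuous_id)
  have hord : OrdConnected (range fun x : ℝ => u (z₀, x)) :=
    isPreconnected_iff_ordConnected.1 (isPreconnected_range hcont)
  -- `c` is constant on the image
  have hlevel : ∀ y ∈ range (fun x : ℝ => u (z₀, x)), c y = c (u (z₀, x₁)) := by
    rintro y ⟨x, rfl⟩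
    exact speed_eq_on_slice hu hcd hPDE hB hk₁ hU₁ z₀ x x₁
  by_contra hne
  rcases lt_or_gt_of_ne hne with hlt | hlt
  · have hsub : Icc (u (z₀, x₁)) (u (z₀, x₂)) ⊆ range fun x : ℝ => u (z₀, x) :=
      hord.out (mem_range_self x₁) (mem_range_self x₂)
    obtain ⟨v, hv, hv'⟩ := hgn _ _ hlt
    exact hv' (deriv_zero_of_const_Ioo hv (fun y hy => hlevel y (hsub (Ioo_subset_Icc_self hy))) (hcd v))
  · have hsub : Icc (u (z₀, x₂)) (u (z₀, x₁)) ⊆ range fun x : ℝ => u (z₀, x) :=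
      hord.out (mem_range_self x₂) (mem_range_self x₁)
    obtain ⟨v, hv, hv'⟩ := hgn _ _ hlt
    exact hv' (deriv_zero_of_const_Ioo hv (fun y hy => hlevel y (hsub (Ioo_subset_Icc_self hy))) (hcd v))

/-- **★ Eternal scalar transport with a nowhere linearly degenerate speed is constant — no sign, no convexity.**  Hypotheses:
`u` differentiable on `ℝ × ℝ` with `u_z + c(u) u_x = 0` everywhere (`z` = first coordinate, two-sided), `c` differentiable with
derivative `c'`, `|c(u)| ≤ B`, `|c'(u)| ≤ k₁`, `|u_x| ≤ U₁` along the solution, and `c' ≢ 0` on every nontrivial interval.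
[folklore] -/
theorem eternal_transport_const (hu : Differentiable ℝ u) (hcd : ∀ v, HasDerivAt c (c' v) v)
    (hPDE : ∀ q, fderiv ℝ u q (1, 0) + c (u q) * fderiv ℝ u q (0, 1) = 0)
    (hB : ∀ q, |c (u q)| ≤ B) (hk₁ : ∀ q, |c' (u q)| ≤ k₁) (hU₁ : ∀ q, |fderiv ℝ u q (0, 1)| ≤ U₁)
    (hgn : ∀ a b : ℝ, a < b → ∃ v ∈ Ioo a b, c' v ≠ 0) :
    ∀ q q' : ℝ × ℝ, u q = u q' := by
  rintro ⟨z, x⟩ ⟨z', x'⟩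
  obtain ⟨X, hX0, hX⟩ := exists_global_char hu hcd hB hk₁ hU₁ z' x'
  obtain ⟨huX, -⟩ := char_is_line hu hPDE hX0 hX
  rw [slice_const hu hcd hPDE hB hk₁ hU₁ hgn z x (X z), huX z]

/-- Under the hypotheses of `eternal_transport_const`, both partial derivatives of `u` vanish identically. [folklore] -/
theorem eternal_transport_fderiv_eq_zero (hu : Differentiable ℝ u) (hcd : ∀ v, HasDerivAt c (c' v) v)
    (hPDE : ∀ q, fderiv ℝ u q (1, 0) + c (u q) * fderiv ℝ u q (0, 1) = 0)
    (hB : ∀ q, |c (u q)| ≤ B) (hk₁ : ∀ q, |c' (u q)| ≤ k₁) (hU₁ : ∀ q, |fderiv ℝ u q (0, 1)| ≤ U₁)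
    (hgn : ∀ a b : ℝ, a < b → ∃ v ∈ Ioo a b, c' v ≠ 0) :
    ∀ q : ℝ × ℝ, fderiv ℝ u q = 0 := by
  have hc : u = fun _ => u (0, 0) := funext fun q => eternal_transport_const hu hcd hPDE hB hk₁ hU₁ hgn q (0, 0)
  intro q
  rw [hc]
  exact fderiv_const_apply _

/-! ## Simple waves of the autonomous p-system: no sign hypothesis on `κ'` -/

variable {w p : ℝ × ℝ → ℝ} {κ κ' : ℝ → ℝ} {κhi W₁ : ℝ}

/-- **A backward-flat solution (`s_x ≡ 0`, i.e. a forward simple wave) is a constant state**, for `κ > 0`, `κ ∈ C¹` nowhere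
linearly degenerate, `κ(w) ≤ κhi`, `|κ'(w)| ≤ k₁`, `|w_x| ≤ W₁` along the solution — and NO hypothesis on the sign of `κ'`.
(`s_x = p_x − κ(w) w_x ≡ 0` and `w_z = −p_x` give the scalar law `w_z + κ(w) w_x = 0`.) [folklore] -/
theorem pSystem_const_of_backward_flat (hw : Differentiable ℝ w) (hp : Differentiable ℝ p)
    (hκd : ∀ v, HasDerivAt κ (κ' v) v)
    (hsys1 : ∀ q, fderiv ℝ p q (1, 0) = -(κ (w q) ^ 2 * fderiv ℝ w q (0, 1)))
    (hsys2 : ∀ q, fderiv ℝ w q (1, 0) = -fderiv ℝ p q (0, 1))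
    (hκpos : ∀ v, 0 < κ v) (hκhi : ∀ q, κ (w q) ≤ κhi) (hk₁ : ∀ q, |κ' (w q)| ≤ k₁)
    (hW₁ : ∀ q, |fderiv ℝ w q (0, 1)| ≤ W₁) (hgn : ∀ a b : ℝ, a < b → ∃ v ∈ Ioo a b, κ' v ≠ 0)
    (hflat : ∀ q, fderiv ℝ p q (0, 1) - κ (w q) * fderiv ℝ w q (0, 1) = 0) :
    ∀ q q' : ℝ × ℝ, w q = w q' ∧ p q = p q' := by
  have hPDE : ∀ q, fderiv ℝ w q (1, 0) + κ (w q) * fderiv ℝ w q (0, 1) = 0 := by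
    intro q; rw [hsys2 q]; linarith [hflat q]
  have hB : ∀ q, |κ (w q)| ≤ κhi := fun q => by rw [abs_of_pos (hκpos _)]; exact hκhi q
  have hDw := eternal_transport_fderiv_eq_zero hw hκd hPDE hB hk₁ hW₁ hgn
  have hDp : ∀ q, fderiv ℝ p q = 0 := fun q => by
    refine ContinuousLinearMap.ext fun v => ?_
    obtain ⟨a, b⟩ := v
    have hpx : fderiv ℝ p q (0, 1) = 0 := by have h := hflat q; rw [hDw q] at h; simpa using h
    have hpz : fderiv ℝ p q (1, 0) = 0 := by rw [hsys1 q, hDw q]; simp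
    rw [Literature.Geometry.Riemannian.clm_prod_apply_eq, hpx, hpz]
    simp
  intro q q'
  exact ⟨is_const_of_fderiv_eq_zero hw hDw q q', is_const_of_fderiv_eq_zero hp hDp q q'⟩

/-- **A forward-flat solution (`r_x ≡ 0`, i.e. a backward simple wave) is a constant state** — same hypotheses, no sign of `κ'`
(`r_x = p_x + κ(w) w_x ≡ 0` and `w_z = −p_x` give `w_z + (−κ)(w) w_x = 0`). [folklore] -/
theorem pSystem_const_of_forward_flat (hw : Differentiable ℝ w) (hp : Differentiable ℝ p)
    (hκd : ∀ v, HasDerivAt κ (κ' v) v)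
    (hsys1 : ∀ q, fderiv ℝ p q (1, 0) = -(κ (w q) ^ 2 * fderiv ℝ w q (0, 1)))
    (hsys2 : ∀ q, fderiv ℝ w q (1, 0) = -fderiv ℝ p q (0, 1))
    (hκpos : ∀ v, 0 < κ v) (hκhi : ∀ q, κ (w q) ≤ κhi) (hk₁ : ∀ q, |κ' (w q)| ≤ k₁)
    (hW₁ : ∀ q, |fderiv ℝ w q (0, 1)| ≤ W₁) (hgn : ∀ a b : ℝ, a < b → ∃ v ∈ Ioo a b, κ' v ≠ 0)
    (hflat : ∀ q, fderiv ℝ p q (0, 1) + κ (w q) * fderiv ℝ w q (0, 1) = 0) :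
    ∀ q q' : ℝ × ℝ, w q = w q' ∧ p q = p q' := by
  have hPDE : ∀ q, fderiv ℝ w q (1, 0) + (fun v => -κ v) (w q) * fderiv ℝ w q (0, 1) = 0 := by
    intro q; simp only; rw [hsys2 q]; linarith [hflat q]
  have hκd' : ∀ v, HasDerivAt (fun v => -κ v) ((fun v => -κ' v) v) v := fun v => (hκd v).neg
  have hB : ∀ q, |(fun v => -κ v) (w q)| ≤ κhi := fun q => by
    simp only [abs_neg]; rw [abs_of_pos (hκpos _)]; exact hκhi q
  have hk₁' : ∀ q, |(fun v => -κ' v) (w q)| ≤ k₁ := fun q => by simp only [abs_neg]; exact hk₁ q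
  have hgn' : ∀ a b : ℝ, a < b → ∃ v ∈ Ioo a b, (fun v => -κ' v) v ≠ 0 := fun a b hab => by
    obtain ⟨v, hv, hv'⟩ := hgn a b hab
    exact ⟨v, hv, by simpa using hv'⟩
  have hDw := eternal_transport_fderiv_eq_zero hw hκd' hPDE hB hk₁' hW₁ hgn'
  have hDp : ∀ q, fderiv ℝ p q = 0 := fun q => by
    refine ContinuousLinearMap.ext fun v => ?_
    obtain ⟨a, b⟩ := v
    have hpx : fderiv ℝ p q (0, 1) = 0 := by have h := hflat q; rw [hDw q] at h; simpa using h
    have hpz : fderiv ℝ p q (1, 0) = 0 := by rw [hsys1 q, hDw q]; simp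
    rw [Literature.Geometry.Riemannian.clm_prod_apply_eq, hpx, hpz]
    simp
  intro q q'
  exact ⟨is_const_of_fderiv_eq_zero hw hDw q q', is_const_of_fderiv_eq_zero hp hDp q q'⟩

/-! ## Travelling waves: no sign hypothesis either -/

/-- **A `C¹` function annihilated by a factor with interval-free zero set is constant.**  If `f' · Φ(f) ≡ 0` with `f'` continuous
and every nontrivial interval contains a point where `Φ ≠ 0`, then `f' ≡ 0`: where `f' ≠ 0` it is nonzero on a neighbourhood, `f`
is non-constant there, its values fill an interval on which `Φ` vanishes. [folklore] -/
theorem deriv_eq_zero_of_mul_eq_zero {f f' Φ : ℝ → ℝ} (hf : ∀ ξ, HasDerivAt f (f' ξ) ξ) (hf'c : Continuous f')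
    (hann : ∀ ξ, f' ξ * Φ (f ξ) = 0) (hΦ : ∀ a b : ℝ, a < b → ∃ v ∈ Ioo a b, Φ v ≠ 0) :
    ∀ ξ, f' ξ = 0 := by
  intro ξ₀
  by_contra hne
  -- `f' ≠ 0` on a ball around `ξ₀`
  obtain ⟨δ, hδ, hball⟩ : ∃ δ > 0, ∀ ξ, dist ξ ξ₀ < δ → f' ξ ≠ 0 := by
    have hev := (hf'c.continuousAt (x := ξ₀)).eventually_ne hne
    obtain ⟨δ, hδ, h⟩ := Metric.eventually_nhds_iff.1 hev
    exact ⟨δ, hδ, fun ξ hξ => h hξ⟩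
  have hΦ0 : ∀ ξ, dist ξ ξ₀ < δ → Φ (f ξ) = 0 := fun ξ hξ =>
    (mul_eq_zero.1 (hann ξ)).resolve_left (hball ξ hξ)
  -- `f ξ₀ ≠ f (ξ₀ + δ/2)` by the mean value theorem
  have hcont : Continuous f := continuous_iff_continuousAt.2 fun ξ => (hf ξ).continuousAt
  have hlt : ξ₀ < ξ₀ + δ / 2 := by linarith
  obtain ⟨η, hη, hηd⟩ := exists_hasDerivAt_eq_slope f f' hlt hcont.continuousOn (fun ξ _ => hf ξ)
  have hηball : dist η ξ₀ < δ := by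
    rw [Real.dist_eq, abs_lt]; constructor <;> linarith [hη.1, hη.2]
  have hneq : f ξ₀ ≠ f (ξ₀ + δ / 2) := by
    intro heq
    have : f' η = 0 := by rw [hηd, heq, sub_self, zero_div]
    exact hball η hηball this
  -- the values between are attained inside the ball, where `Φ ∘ f = 0`
  have hIcc_ball : ∀ ξ ∈ Icc ξ₀ (ξ₀ + δ / 2), dist ξ ξ₀ < δ := fun ξ hξ => by
    rw [Real.dist_eq, abs_lt]; constructor <;> linarith [hξ.1, hξ.2]
  rcases lt_or_gt_of_ne hneq with h | h
  · obtain ⟨v, hv, hv'⟩ := hΦ _ _ h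
    obtain ⟨ξ, hξ, hξv⟩ := intermediate_value_Icc hlt.le hcont.continuousOn (Ioo_subset_Icc_self hv)
    exact hv' (hξv ▸ hΦ0 ξ (hIcc_ball ξ hξ))
  · obtain ⟨v, hv, hv'⟩ := hΦ _ _ h
    obtain ⟨ξ, hξ, hξv⟩ := intermediate_value_Icc' hlt.le hcont.continuousOn (Ioo_subset_Icc_self hv)
    exact hv' (hξv ▸ hΦ0 ξ (hIcc_ball ξ hξ))

/-- Under the hypotheses of `deriv_eq_zero_of_mul_eq_zero`, `f` is constant. [folklore] -/
theorem const_of_mul_eq_zero {f f' Φ : ℝ → ℝ} (hf : ∀ ξ, HasDerivAt f (f' ξ) ξ) (hf'c : Continuous f')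
    (hann : ∀ ξ, f' ξ * Φ (f ξ) = 0) (hΦ : ∀ a b : ℝ, a < b → ∃ v ∈ Ioo a b, Φ v ≠ 0) :
    ∀ ξ ξ', f ξ = f ξ' := by
  have h0 := deriv_eq_zero_of_mul_eq_zero hf hf'c hann hΦ
  exact is_const_of_deriv_eq_zero (fun ξ => (hf ξ).differentiableAt) fun ξ => by rw [(hf ξ).deriv, h0 ξ]

/-- The zero set of `v ↦ σ² − κ(v)²` contains no interval when `κ > 0` is nowhere linearly degenerate: on an interval where
`κ² ≡ σ²` the positive function `κ` is the constant `√(σ²) = |σ|`, so `κ' ≡ 0` there. [folklore] -/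
theorem sonic_set_interval_free (hκd : ∀ v, HasDerivAt κ (κ' v) v) (hκpos : ∀ v, 0 < κ v)
    (hgn : ∀ a b : ℝ, a < b → ∃ v ∈ Ioo a b, κ' v ≠ 0) (σ : ℝ) :
    ∀ a b : ℝ, a < b → ∃ v ∈ Ioo a b, σ ^ 2 - κ v ^ 2 ≠ 0 := by
  intro a b hab
  by_contra hnot
  push Not at hnot
  -- `κ = √(σ²)` on `Ioo a b`
  have hκeq : ∀ y ∈ Ioo a b, κ y = Real.sqrt (σ ^ 2) := by
    intro y hy
    have h := hnot y hy
    have hsq : κ y ^ 2 = σ ^ 2 := by linarith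
    rw [← hsq, Real.sqrt_sq (hκpos y).le]
  obtain ⟨v, hv, hv'⟩ := hgn a b hab
  exact hv' (deriv_zero_of_const_Ioo (c := κ) (c' := κ') hv hκeq (hκd v))

/-- **Travelling waves of the p-system are constant states, with no sign hypothesis on `κ'`.**  If `f, g ∈ C¹(ℝ)` and
`(w, p)(z, x) = (f, g)(x − σ z)` solves `p_z = −κ(w)² w_x`, `w_z = −p_x` — which for profiles reads `σ f' = g'` and
`σ g' = κ(f)² f'`, hence `f' (σ² − κ(f)²) = 0` — then `f` and `g` are constant (`κ > 0`, `κ ∈ C¹` nowhere linearly degenerate).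
Stated directly on the profile equations. [folklore] -/
theorem travellingWave_const {f g f' g' : ℝ → ℝ} {σ : ℝ} (hf : ∀ ξ, HasDerivAt f (f' ξ) ξ) (hf'c : Continuous f')
    (hg : ∀ ξ, HasDerivAt g (g' ξ) ξ)
    (h1 : ∀ ξ, σ * f' ξ = g' ξ) (h2 : ∀ ξ, σ * g' ξ = κ (f ξ) ^ 2 * f' ξ)
    (hκd : ∀ v, HasDerivAt κ (κ' v) v) (hκpos : ∀ v, 0 < κ v)
    (hgn : ∀ a b : ℝ, a < b → ∃ v ∈ Ioo a b, κ' v ≠ 0) :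
    (∀ ξ ξ', f ξ = f ξ') ∧ ∀ ξ ξ', g ξ = g ξ' := by
  have hann : ∀ ξ, f' ξ * (σ ^ 2 - κ (f ξ) ^ 2) = 0 := by
    intro ξ
    have := h2 ξ
    rw [← h1 ξ] at this
    linear_combination this
  have hf0 := deriv_eq_zero_of_mul_eq_zero hf hf'c hann (sonic_set_interval_free hκd hκpos hgn σ)
  refine ⟨const_of_mul_eq_zero hf hf'c hann (sonic_set_interval_free hκd hκpos hgn σ), ?_⟩
  have hg0 : ∀ ξ, g' ξ = 0 := fun ξ => by rw [← h1 ξ, hf0 ξ, mul_zero]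
  exact is_const_of_deriv_eq_zero (fun ξ => (hg ξ).differentiableAt) fun ξ => by rw [(hg ξ).deriv, hg0 ξ]

end Summit.NavierStokesRegularity.NavierStokesRegularity.Theorems.PoloidalWindowDoorPoloidalWindowRigidityZShockScalarEternal

end
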